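import Literature.AnabelianGeometry.EtaleTheta.Discharge.Sec5KummerGaloisDictionary

/-!
# [EtTh] §5, Lemma 5.9 (iv) / Theorem 5.10 (iii): every certificate at `DK₀` is one for the honest `K^×`-part — with the continuous Kummer input, and from the Galois dictionary (pp. 332–334 / PDF pp. 106–108)

Mochizuki, *The étale theta function …*, Publ. RIMS **45** (2009)
[cite: MochizukiEtTh2009, Lem 5.9 (iv) p.332 (PDF p.106); Thm 5.10 (iii) p.334 (PDF p.108)].  Layer L2 of the
abc-iut cell, seat abc-iut-L2-t11 (gen 3); PROOF-ONLY sequel of this seat's `Sec5KummerOutCanonical.lean` (gen 2)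
and `Sec5KummerGaloisDictionary.lean` (gen 3); nothing landed is edited.

Gen 2 proved that the bi-theta / mono-theta environment data on `E^Π_N` formed with the intrinsic `K^×`-part
`kummerOut` ("the natural outer actions of `l·ℤ`, `K^×` [cf. Lemma 5.8] on `E_N`", Lemma 5.9 (iv)) and with the
instance of record `DK₀ := transport⁻¹(kummerOut(D_Y))` COINCIDE (`frdBiThetaEnv_kummerOut_eq`, …, and the
transfer `monoThetaEnvCompat_kummerOut_iff` of Theorem 5.10 (iii)'s compatibility clause), under the inflation
input `hinfl` and the ALGEBRAIC Kummer input `hKum`.  Here are the same four statements (1) with `hKum` weakened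
to the CONTINUOUS input `hKumC` of abc-iut-L6-t23's `Sec5KummerOutReachedContinuous.lean` (ruling of
abc-iut-L2-lead 02:30:52Z: print's `H¹(G_K, μ_N)` is the continuous one), and (2) with BOTH arithmetic inputs
replaced by the Galois dictionary of the constants (binders `e, j, ν` + laws of `Sec5KummerGaloisDictionary.lean`;
Kummer theory = abc-iut-w5-d234's `AlgEquiv.exists_kummer_eq_of_isOpen`, consumed through `hKumC_of_hilbert90`).
So: Lemma 5.9 (iv) canonical (this seat), Theorem 5.10 (iii) at `DK₀` (abc-iut-L6-t23,
`Sec5Thm510iiiKummerPart.lean`) and every `FrdIsMonoThetaEnv`-consumer ([IUTchII] Prop. 1.2 (ii) bridge) read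
verbatim at print's `⟨l·ℤ, K^×⟩`-environment, modulo the dictionary only.  HONEST FRAMING: kernel-checked
implications; dictionary binders are hypotheses to be instantiated at the genuine data (W3-L2-01; `T`-side done
in `Sec2GaloisDictionaryOfSetting.lean`); nothing of [EtTh] is asserted unconditionally; typed ≠ proved; no
side is taken on anything downstream ([IUTchIII] Cor. 3.12).
-/

noncomputable section

namespace Literature.AnabelianGeometry.EtaleTheta

open CategoryTheory

universe w v v' u u'

namespace ThetaFrobenioid

variable {C : Type u} [Category.{v} C] {D : Type u'} [Category.{v'} D] {𝔉 : ThetaFrobenioid.{w} C D}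

namespace BiratAutAction

variable (α : 𝔉.BiratAutAction) (hK : 𝔉.KxRootNModCyclotome) (H : 𝔉.Facts) (h1 : 𝔉.SectionsFactor)
  (h3 : 𝔉.OuterActionLZ) (hsec : 𝔉.SgpCapSection) (hcs : 𝔉.SgpCupSection) (h8 : 𝔉.ConstantsEqNormalizer)
  (T : ThetaEnvData.{v} 𝔉.N) (ι : 𝔉.PiX ≃ₜ* T.PiX) (m : 𝔉.muTorsion 𝔉.BN 𝔉.N ≃* T.mu)
  (hY : 𝔉.IdentifiesPiY T ι.toMulEquiv)

/-! ### (1) The transfers with the CONTINUOUS Kummer input `hKumC` -/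

section Continuous

variable (hχ : 𝔉.CyclotomicCharacterCompat T ι.toMulEquiv m)

/-- The bi-theta environment data on `E^Π_N` at the intrinsic `K^×`-part EQUAL those at `DK₀`, given `hinfl` and the
CONTINUOUS `hKumC` (gen 2's `frdBiThetaEnv_kummerOut_eq` with `hKum ↦ hKumC`).
[cite: MochizukiEtTh2009, Lem 5.9 (iv) p.332 (PDF p.106)] -/
theorem frdBiThetaEnv_kummerOut_eq_of_continuous
    (hinfl : ∀ f : 𝔉.KxRootN, ∃ δ₀ : T.G → T.mu, ∀ (y : 𝔉.PiX), y ∈ 𝔉.PiY →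
      m (α.kummerCocycle hK f (𝔉.sgpCap (𝔉.ρ y))) = δ₀ (T.aug (ι y)))
    (hKumC : ∀ (δ₀ : T.G → T.mu) (hδ : CycEnvelope.IsEnvCocycle T.augY T.chi (δ₀ ∘ T.augY)),
      CycEnvelope.shift hδ ∈ contMulAut T.env →
      ∃ (f : 𝔉.KxRootN) (a : T.mu), ∀ p : T.PiY,
        δ₀ (T.augY p) = (α.kummerCocycleY hK f T ι.toMulEquiv m p)⁻¹ * CycEnvelope.coboundary T.augY T.chi a p) :
    𝔉.frdBiThetaEnv h1 h3 hsec hcs h8 (α.kummerOut hK) =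
      𝔉.frdBiThetaEnv h1 h3 hsec hcs h8 (TopOut.transport (𝔉.envContIso H T ι m hY hχ) ⁻¹' T.kummerOut) := by
  have hD := α.D_kummerOut_eq_of_continuous hK H h1 h3 hsec hcs h8 T ι m hY hχ hinfl hKumC
  exact congrArg (fun D' : Subgroup (TopOut 𝔉.EPiN) =>
    ({ Pi := 𝔉.EPiN, D := D', sTheta := 𝔉.muConjClass (𝔉.sCupPi h1 hcs).range,
       sAlg := 𝔉.muConjClass (𝔉.sCapPi hsec).range } : BiThetaEnv.{v})) hD

/-- The mono-theta environments at the intrinsic `K^×`-part and at `DK₀` are EQUAL, given `hinfl` and `hKumC`.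
[cite: MochizukiEtTh2009, Lem 5.9 (iv) p.332 (PDF p.106)] -/
theorem frdMonoThetaEnv_kummerOut_eq_of_continuous
    (hinfl : ∀ f : 𝔉.KxRootN, ∃ δ₀ : T.G → T.mu, ∀ (y : 𝔉.PiX), y ∈ 𝔉.PiY →
      m (α.kummerCocycle hK f (𝔉.sgpCap (𝔉.ρ y))) = δ₀ (T.aug (ι y)))
    (hKumC : ∀ (δ₀ : T.G → T.mu) (hδ : CycEnvelope.IsEnvCocycle T.augY T.chi (δ₀ ∘ T.augY)),
      CycEnvelope.shift hδ ∈ contMulAut T.env →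
      ∃ (f : 𝔉.KxRootN) (a : T.mu), ∀ p : T.PiY,
        δ₀ (T.augY p) = (α.kummerCocycleY hK f T ι.toMulEquiv m p)⁻¹ * CycEnvelope.coboundary T.augY T.chi a p) :
    𝔉.frdMonoThetaEnv h1 h3 hsec hcs h8 (α.kummerOut hK) =
      𝔉.frdMonoThetaEnv h1 h3 hsec hcs h8 (TopOut.transport (𝔉.envContIso H T ι m hY hχ) ⁻¹' T.kummerOut) := by
  unfold ThetaFrobenioid.frdMonoThetaEnv
  rw [α.frdBiThetaEnv_kummerOut_eq_of_continuous hK H h1 h3 hsec hcs h8 T ι m hY hχ hinfl hKumC]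

/-- Lemma 5.9 (iv) "In particular" (`FrdIsMonoThetaEnv`) at the intrinsic `K^×`-part and at `DK₀` are
EQUIVALENT for any comparison data `T'`, given `hinfl` and `hKumC`.  [cite: MochizukiEtTh2009, Lem 5.9 (iv) p.332 (PDF p.106)] -/
theorem frdIsMonoThetaEnv_kummerOut_iff_of_continuous
    (hinfl : ∀ f : 𝔉.KxRootN, ∃ δ₀ : T.G → T.mu, ∀ (y : 𝔉.PiX), y ∈ 𝔉.PiY →
      m (α.kummerCocycle hK f (𝔉.sgpCap (𝔉.ρ y))) = δ₀ (T.aug (ι y)))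
    (hKumC : ∀ (δ₀ : T.G → T.mu) (hδ : CycEnvelope.IsEnvCocycle T.augY T.chi (δ₀ ∘ T.augY)),
      CycEnvelope.shift hδ ∈ contMulAut T.env →
      ∃ (f : 𝔉.KxRootN) (a : T.mu), ∀ p : T.PiY,
        δ₀ (T.augY p) = (α.kummerCocycleY hK f T ι.toMulEquiv m p)⁻¹ * CycEnvelope.coboundary T.augY T.chi a p)
    (T' : ThetaEnvData.{v} 𝔉.N) :
    𝔉.FrdIsMonoThetaEnv h1 h3 hsec hcs h8 (α.kummerOut hK) T' ↔
      𝔉.FrdIsMonoThetaEnv h1 h3 hsec hcs h8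
        (TopOut.transport (𝔉.envContIso H T ι m hY hχ) ⁻¹' T.kummerOut) T' := by
  unfold ThetaFrobenioid.FrdIsMonoThetaEnv
  rw [α.frdMonoThetaEnv_kummerOut_eq_of_continuous hK H h1 h3 hsec hcs h8 T ι m hY hχ hinfl hKumC]

set_option maxHeartbeats 400000 in
/-- Theorem 5.10 (iii)'s compatibility clause (abc-iut-L2-t4's `MonoThetaEnvCompat`) at the intrinsic `K^×`-part
and at `DK₀` are EQUIVALENT, given `hinfl` and `hKumC` (gen 2's `monoThetaEnvCompat_kummerOut_iff` with
`hKum ↦ hKumC`): a certificate of "print's 𝕄(𝔉) at `DK₀`" (abc-iut-L6-t23) is one for the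
`⟨l·ℤ, K^×⟩`-environment.  [cite: MochizukiEtTh2009, Thm 5.10 (iii) p.334 (PDF p.108)] -/
theorem monoThetaEnvCompat_kummerOut_iff_of_continuous
    (hinfl : ∀ f : 𝔉.KxRootN, ∃ δ₀ : T.G → T.mu, ∀ (y : 𝔉.PiX), y ∈ 𝔉.PiY →
      m (α.kummerCocycle hK f (𝔉.sgpCap (𝔉.ρ y))) = δ₀ (T.aug (ι y)))
    (hKumC : ∀ (δ₀ : T.G → T.mu) (hδ : CycEnvelope.IsEnvCocycle T.augY T.chi (δ₀ ∘ T.augY)),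
      CycEnvelope.shift hδ ∈ contMulAut T.env →
      ∃ (f : 𝔉.KxRootN) (a : T.mu), ∀ p : T.PiY,
        δ₀ (T.augY p) = (α.kummerCocycleY hK f T ι.toMulEquiv m p)⁻¹ * CycEnvelope.coboundary T.augY T.chi a p)
    (Ψ : C ≌ C) (β : Ψ.functor.obj 𝔉.BN ≅ 𝔉.BN) (ψY : 𝔉.PiX ≃ₜ* 𝔉.PiX)
    (hbase : ∀ g : 𝔉.PiX, 𝔉.autBase 𝔉.BN (𝔉.psiAut Ψ β (𝔉.sgpCap (𝔉.ρ g))) = 𝔉.ρ (ψY g))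
    (hψY : 𝔉.PiY.map ψY.toMulEquiv.toMonoidHom = 𝔉.PiY)
    (hψYdd : 𝔉.PiYdd.map ψY.toMulEquiv.toMonoidHom = 𝔉.PiYdd) :
    𝔉.MonoThetaEnvCompat h1 h3 hsec hcs h8 (α.kummerOut hK) Ψ β ψY hbase hψY hψYdd ↔
      𝔉.MonoThetaEnvCompat h1 h3 hsec hcs h8
        (TopOut.transport (𝔉.envContIso H T ι m hY hχ) ⁻¹' T.kummerOut) Ψ β ψY hbase hψY hψYdd := by
  have hD := α.D_kummerOut_eq_of_continuous hK H h1 h3 hsec hcs h8 T ι m hY hχ hinfl hKumC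
  constructor
  · rintro ⟨x₃, γ, k, hk, hx⟩
    refine ⟨x₃, ⟨γ.e, ?_, γ.map_sTheta⟩, k, hk, hx⟩
    change ((𝔉.frdBiThetaEnv h1 h3 hsec hcs h8
        (TopOut.transport (𝔉.envContIso H T ι m hY hχ) ⁻¹' T.kummerOut)).D).map _ =
      (𝔉.frdBiThetaEnv h1 h3 hsec hcs h8 (TopOut.transport (𝔉.envContIso H T ι m hY hχ) ⁻¹' T.kummerOut)).D
    rw [← hD]
    exact γ.map_D
  · rintro ⟨x₃, γ, k, hk, hx⟩
    refine ⟨x₃, ⟨γ.e, ?_, γ.map_sTheta⟩, k, hk, hx⟩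
    change ((𝔉.frdBiThetaEnv h1 h3 hsec hcs h8 (α.kummerOut hK)).D).map _ =
      (𝔉.frdBiThetaEnv h1 h3 hsec hcs h8 (α.kummerOut hK)).D
    rw [hD]
    exact γ.map_D

end Continuous

/-! ### (2) The transfers FROM THE GALOIS DICTIONARY (no arithmetic hypothesis left) -/

section Dictionary

variable {F : Type*} {L : Type*} [Field F] [Field L] [Algebra F L]
  (e : T.G ≃* (L ≃ₐ[F] L)) (j : T.mu →* Lˣ) (ν : 𝔉.KxRootN →* Lˣ)

/-- The bi-theta environment data on `E^Π_N` at the intrinsic `K^×`-part EQUAL those at `DK₀`, FROM THE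
DICTIONARY.  [cite: MochizukiEtTh2009, Lem 5.9 (iv) p.332 (PDF p.106)] -/
theorem frdBiThetaEnv_kummerOut_eq_of_galoisDictionary [Normal F L] [NeZero ((𝔉.N : ℕ) : F)]
    (hj : Function.Injective j) (hjN : ∀ z : Lˣ, z ^ (𝔉.N : ℕ) = 1 → z ∈ j.range)
    (hchi : ∀ (g : T.G) (x : T.mu), j (T.chi g x) = e g • j x)
    (hνμ : ∀ u : 𝔉.muTorsion 𝔉.BN 𝔉.N, ν ⟨𝔉.muToBirat u, 𝔉.muToBirat_mem_KxRootN u⟩ = j (m u))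
    (hνeq : ∀ (f : 𝔉.KxRootN) (y : 𝔉.PiX),
      j (m (α.kummerCocycle hK f (𝔉.sgpCap (𝔉.ρ y)))) * ν f = e (T.aug (ι y)) • ν f)
    (hνN : ∀ y : Fˣ, ∃ f : 𝔉.KxRootN, ((ν f : Lˣ) : L) ^ (𝔉.N : ℕ) = algebraMap F L y)
    (haugY : Function.Surjective T.augY) (hopen : IsOpenMap fun p : T.PiY => e (T.augY p)) :
    𝔉.frdBiThetaEnv h1 h3 hsec hcs h8 (α.kummerOut hK) =
      𝔉.frdBiThetaEnv h1 h3 hsec hcs h8 (TopOut.transport (𝔉.envContIso H T ι m hY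
        (α.cyclotomicCharacterCompatX_of_galoisDictionary hK T ι m e j ν hj hchi hνμ hνeq).toY) ⁻¹'
          T.kummerOut) :=
  α.frdBiThetaEnv_kummerOut_eq_of_continuous hK H h1 h3 hsec hcs h8 T ι m hY _
    (α.hinfl_of_geometric hK T ι m (α.hgeom_of_galoisDictionary hK T ι m e j ν hj hνeq))
    (α.hKumC_of_hilbert90 hK T ι m e j ν hj hjN hchi hνeq hνN haugY hopen)

/-- The mono-theta environments at the intrinsic `K^×`-part and at `DK₀` are EQUAL, FROM THE DICTIONARY.
[cite: MochizukiEtTh2009, Lem 5.9 (iv) p.332 (PDF p.106)] -/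
theorem frdMonoThetaEnv_kummerOut_eq_of_galoisDictionary [Normal F L] [NeZero ((𝔉.N : ℕ) : F)]
    (hj : Function.Injective j) (hjN : ∀ z : Lˣ, z ^ (𝔉.N : ℕ) = 1 → z ∈ j.range)
    (hchi : ∀ (g : T.G) (x : T.mu), j (T.chi g x) = e g • j x)
    (hνμ : ∀ u : 𝔉.muTorsion 𝔉.BN 𝔉.N, ν ⟨𝔉.muToBirat u, 𝔉.muToBirat_mem_KxRootN u⟩ = j (m u))
    (hνeq : ∀ (f : 𝔉.KxRootN) (y : 𝔉.PiX),
      j (m (α.kummerCocycle hK f (𝔉.sgpCap (𝔉.ρ y)))) * ν f = e (T.aug (ι y)) • ν f)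
    (hνN : ∀ y : Fˣ, ∃ f : 𝔉.KxRootN, ((ν f : Lˣ) : L) ^ (𝔉.N : ℕ) = algebraMap F L y)
    (haugY : Function.Surjective T.augY) (hopen : IsOpenMap fun p : T.PiY => e (T.augY p)) :
    𝔉.frdMonoThetaEnv h1 h3 hsec hcs h8 (α.kummerOut hK) =
      𝔉.frdMonoThetaEnv h1 h3 hsec hcs h8 (TopOut.transport (𝔉.envContIso H T ι m hY
        (α.cyclotomicCharacterCompatX_of_galoisDictionary hK T ι m e j ν hj hchi hνμ hνeq).toY) ⁻¹'
          T.kummerOut) :=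
  α.frdMonoThetaEnv_kummerOut_eq_of_continuous hK H h1 h3 hsec hcs h8 T ι m hY _
    (α.hinfl_of_geometric hK T ι m (α.hgeom_of_galoisDictionary hK T ι m e j ν hj hνeq))
    (α.hKumC_of_hilbert90 hK T ι m e j ν hj hjN hchi hνeq hνN haugY hopen)

/-- `FrdIsMonoThetaEnv` at the intrinsic `K^×`-part and at `DK₀` are EQUIVALENT, FROM THE DICTIONARY — so the
[IUTchII] Prop. 1.2 (ii) binder `hM` may be certified at either.  [cite: MochizukiEtTh2009, Lem 5.9 (iv) p.332 (PDF p.106)] -/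
theorem frdIsMonoThetaEnv_kummerOut_iff_of_galoisDictionary [Normal F L] [NeZero ((𝔉.N : ℕ) : F)]
    (hj : Function.Injective j) (hjN : ∀ z : Lˣ, z ^ (𝔉.N : ℕ) = 1 → z ∈ j.range)
    (hchi : ∀ (g : T.G) (x : T.mu), j (T.chi g x) = e g • j x)
    (hνμ : ∀ u : 𝔉.muTorsion 𝔉.BN 𝔉.N, ν ⟨𝔉.muToBirat u, 𝔉.muToBirat_mem_KxRootN u⟩ = j (m u))
    (hνeq : ∀ (f : 𝔉.KxRootN) (y : 𝔉.PiX),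
      j (m (α.kummerCocycle hK f (𝔉.sgpCap (𝔉.ρ y)))) * ν f = e (T.aug (ι y)) • ν f)
    (hνN : ∀ y : Fˣ, ∃ f : 𝔉.KxRootN, ((ν f : Lˣ) : L) ^ (𝔉.N : ℕ) = algebraMap F L y)
    (haugY : Function.Surjective T.augY) (hopen : IsOpenMap fun p : T.PiY => e (T.augY p))
    (T' : ThetaEnvData.{v} 𝔉.N) :
    𝔉.FrdIsMonoThetaEnv h1 h3 hsec hcs h8 (α.kummerOut hK) T' ↔
      𝔉.FrdIsMonoThetaEnv h1 h3 hsec hcs h8 (TopOut.transport (𝔉.envContIso H T ι m hY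
        (α.cyclotomicCharacterCompatX_of_galoisDictionary hK T ι m e j ν hj hchi hνμ hνeq).toY) ⁻¹'
          T.kummerOut) T' :=
  α.frdIsMonoThetaEnv_kummerOut_iff_of_continuous hK H h1 h3 hsec hcs h8 T ι m hY _
    (α.hinfl_of_geometric hK T ι m (α.hgeom_of_galoisDictionary hK T ι m e j ν hj hνeq))
    (α.hKumC_of_hilbert90 hK T ι m e j ν hj hjN hchi hνeq hνN haugY hopen) T'

/-- Theorem 5.10 (iii)'s compatibility clause at the intrinsic `K^×`-part and at `DK₀` are EQUIVALENT, FROM THE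
DICTIONARY.  [cite: MochizukiEtTh2009, Thm 5.10 (iii) p.334 (PDF p.108)] -/
theorem monoThetaEnvCompat_kummerOut_iff_of_galoisDictionary [Normal F L] [NeZero ((𝔉.N : ℕ) : F)]
    (hj : Function.Injective j) (hjN : ∀ z : Lˣ, z ^ (𝔉.N : ℕ) = 1 → z ∈ j.range)
    (hchi : ∀ (g : T.G) (x : T.mu), j (T.chi g x) = e g • j x)
    (hνμ : ∀ u : 𝔉.muTorsion 𝔉.BN 𝔉.N, ν ⟨𝔉.muToBirat u, 𝔉.muToBirat_mem_KxRootN u⟩ = j (m u))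
    (hνeq : ∀ (f : 𝔉.KxRootN) (y : 𝔉.PiX),
      j (m (α.kummerCocycle hK f (𝔉.sgpCap (𝔉.ρ y)))) * ν f = e (T.aug (ι y)) • ν f)
    (hνN : ∀ y : Fˣ, ∃ f : 𝔉.KxRootN, ((ν f : Lˣ) : L) ^ (𝔉.N : ℕ) = algebraMap F L y)
    (haugY : Function.Surjective T.augY) (hopen : IsOpenMap fun p : T.PiY => e (T.augY p))
    (Ψ : C ≌ C) (β : Ψ.functor.obj 𝔉.BN ≅ 𝔉.BN) (ψY : 𝔉.PiX ≃ₜ* 𝔉.PiX)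
    (hbase : ∀ g : 𝔉.PiX, 𝔉.autBase 𝔉.BN (𝔉.psiAut Ψ β (𝔉.sgpCap (𝔉.ρ g))) = 𝔉.ρ (ψY g))
    (hψY : 𝔉.PiY.map ψY.toMulEquiv.toMonoidHom = 𝔉.PiY)
    (hψYdd : 𝔉.PiYdd.map ψY.toMulEquiv.toMonoidHom = 𝔉.PiYdd) :
    𝔉.MonoThetaEnvCompat h1 h3 hsec hcs h8 (α.kummerOut hK) Ψ β ψY hbase hψY hψYdd ↔
      𝔉.MonoThetaEnvCompat h1 h3 hsec hcs h8 (TopOut.transport (𝔉.envContIso H T ι m hY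
        (α.cyclotomicCharacterCompatX_of_galoisDictionary hK T ι m e j ν hj hchi hνμ hνeq).toY) ⁻¹'
          T.kummerOut) Ψ β ψY hbase hψY hψYdd :=
  α.monoThetaEnvCompat_kummerOut_iff_of_continuous hK H h1 h3 hsec hcs h8 T ι m hY _
    (α.hinfl_of_geometric hK T ι m (α.hgeom_of_galoisDictionary hK T ι m e j ν hj hνeq))
    (α.hKumC_of_hilbert90 hK T ι m e j ν hj hjN hchi hνeq hνN haugY hopen) Ψ β ψY hbase hψY hψYdd

end Dictionary

end BiratAutAction

end ThetaFrobenioid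

end Literature.AnabelianGeometry.EtaleTheta

end
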